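import Summits.ValiantsHypothesis.ValiantsHypothesis.Theses.LiouvilleSarnak

/-!
# ValiantsHypothesis / LiouvilleSarnak — item `SarnakImpliesHard` (stmt-ValiantsHypothesis-14778), closed

`AlgebraicSarnak → LiouvilleNotInVP`: if the Liouville family `Λ` were in `VP_ℂ` then
`L(Λ_m) ≤ m^c + c` for all `m`; for `f = Λ_m` the left side of `AlgebraicSarnak` is
`|Σ_e λ_e · λ_e|² = |2^m|² = 4^m` (the coefficient of `x^e` in `Λ_m` is `λ_e = λ(1 + bin e) = ±1`)
and the right side is `ε · 2^m · Σ_{d ∈ supp Λ_m} |coeff_d Λ_m|² ≤ ε · 2^m · 2^m`; at `ε = 1/2`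
this is `4^m ≤ 4^m / 2`, absurd. HONEST FRAMING: bookkeeping; `AlgebraicSarnak` is an OPEN
conjecture-shaped crux; nothing here is progress on `VP ≠ VNP`.
-/

-- layout Summits/ValiantsHypothesis/ValiantsHypothesis forces the duplicated namespace component
set_option linter.dupNamespace false

namespace Summit.ValiantsHypothesis.ValiantsHypothesis.Theorems.LiouvilleSarnak

open Literature.Computability.AlgebraicComplexity MvPolynomial

/-- The selector product `a · Π_{i : e i} X_i` is the monomial `a · x^e`. [folklore] -/
private theorem C_mul_prod_ite_eq_monomial {m : ℕ} (e : Fin m → Bool) (a : ℂ) :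
    C a * ∏ i : Fin m, (if e i then X i else (1 : MvPolynomial (Fin m) ℂ)) =
      monomial (Finsupp.equivFunOnFinite.symm fun i => (e i).toNat) a := by
  rw [monomial_eq, Finsupp.prod_fintype _ _ (fun i => pow_zero _)]
  congr 1
  refine Finset.prod_congr rfl (fun i _ => ?_)
  cases h : e i <;> simp [h]

/-- `e ↦ x^e` is injective on `{0,1}^m`. [folklore] -/
private theorem expVec_injective (m : ℕ) : Function.Injective
    (fun e : Fin m → Bool => (Finsupp.equivFunOnFinite.symm fun i => (e i).toNat : Fin m →₀ ℕ)) := by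
  intro e e' h
  funext i
  have hi := congrArg (fun f : Fin m →₀ ℕ => f i) h
  simp only [Finsupp.coe_equivFunOnFinite_symm] at hi
  revert hi
  cases e i <;> cases e' i <;> simp

/-- The coefficient of `x^e` in `Λ_m` is `λ(1 + bin e)`. [folklore] -/
private theorem coeff_expVec_liouvillePoly {m : ℕ} (e : Fin m → Bool) :
    coeff (Finsupp.equivFunOnFinite.symm fun i => (e i).toNat)
      (∑ e' : Fin m → Bool, C ((ArithmeticFunction.liouville (Nat.ofBits e' + 1) : ℤ) : ℂ) *
        ∏ i : Fin m, (if e' i then X i else (1 : MvPolynomial (Fin m) ℂ))) =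
      ((ArithmeticFunction.liouville (Nat.ofBits e + 1) : ℤ) : ℂ) := by
  simp_rw [C_mul_prod_ite_eq_monomial]
  rw [coeff_sum, Finset.sum_eq_single e]
  · rw [coeff_monomial, if_pos rfl]
  · intro e' _ hne
    rw [coeff_monomial, if_neg]
    exact fun h => hne (expVec_injective m h)
  · exact fun h => absurd (Finset.mem_univ e) h

/-- A monomial which is not some `x^e`, `e ∈ {0,1}^m`, has coefficient `0` in `Λ_m`. [folklore] -/
private theorem coeff_liouvillePoly_eq_zero {m : ℕ} (d : Fin m →₀ ℕ)
    (hd : ∀ e : Fin m → Bool, (Finsupp.equivFunOnFinite.symm fun i => (e i).toNat) ≠ d) :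
    coeff d (∑ e' : Fin m → Bool, C ((ArithmeticFunction.liouville (Nat.ofBits e' + 1) : ℤ) : ℂ) *
        ∏ i : Fin m, (if e' i then X i else (1 : MvPolynomial (Fin m) ℂ))) = 0 := by
  simp_rw [C_mul_prod_ite_eq_monomial]
  rw [coeff_sum]
  exact Finset.sum_eq_zero fun e _ => by rw [coeff_monomial, if_neg (hd e)]

/-- `λ(n)² = 1` for `n ≥ 1`, in `ℂ`. [folklore] -/
private theorem liouville_mul_self (n : ℕ) :
    ((ArithmeticFunction.liouville (n + 1) : ℤ) : ℂ) * ((ArithmeticFunction.liouville (n + 1) : ℤ) : ℂ)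
      = 1 := by
  rw [← Int.cast_mul, ArithmeticFunction.liouville_apply (Nat.succ_ne_zero n), ← pow_add, ← two_mul,
    pow_mul]
  simp

/-- **Item `SarnakImpliesHard` (stmt-ValiantsHypothesis-14778):** `AlgebraicSarnak → LiouvilleNotInVP`.
[folklore] -/
theorem sarnakImpliesHard_proof : Theses.LiouvilleSarnak.SarnakImpliesHard := by
  unfold Theses.LiouvilleSarnak.SarnakImpliesHard Theses.LiouvilleSarnak.AlgebraicSarnak
    Theses.LiouvilleSarnak.LiouvilleNotInVP
  intro hS hVP
  simp only [VP, Set.mem_setOf_eq] at hVP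
  obtain ⟨c, hc⟩ := hVP.2
  obtain ⟨m, hm⟩ := hS c (1 / 2) (by norm_num)
  have h := hm m le_rfl _ (hc m)
  -- the number of cube points
  have hcard : (Finset.univ : Finset (Fin m → Bool)).card = 2 ^ m := by
    rw [Finset.card_univ, Fintype.card_fun, Fintype.card_bool, Fintype.card_fin]
  -- left side `= 4^m`
  have hL : ‖∑ e : Fin m → Bool, ((ArithmeticFunction.liouville (Nat.ofBits e + 1) : ℤ) : ℂ) *
      coeff (Finsupp.equivFunOnFinite.symm fun i => (e i).toNat)
        (∑ e' : Fin m → Bool, C ((ArithmeticFunction.liouville (Nat.ofBits e' + 1) : ℤ) : ℂ) *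
          ∏ i : Fin m, (if e' i then X i else (1 : MvPolynomial (Fin m) ℂ)))‖ ^ 2 = (4 : ℝ) ^ m := by
    simp_rw [coeff_expVec_liouvillePoly, liouville_mul_self]
    rw [Finset.sum_const, hcard, nsmul_eq_mul, mul_one]
    push_cast
    rw [norm_pow, Complex.norm_two, ← pow_mul, show (4 : ℝ) = 2 ^ 2 by norm_num, ← pow_mul,
      mul_comm 2 m]
  -- right side sum `≤ 2^m`
  have hR : ∑ d ∈ (∑ e' : Fin m → Bool, C ((ArithmeticFunction.liouville (Nat.ofBits e' + 1) : ℤ) : ℂ) *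
        ∏ i : Fin m, (if e' i then X i else (1 : MvPolynomial (Fin m) ℂ))).support,
      ‖coeff d (∑ e' : Fin m → Bool, C ((ArithmeticFunction.liouville (Nat.ofBits e' + 1) : ℤ) : ℂ) *
        ∏ i : Fin m, (if e' i then X i else (1 : MvPolynomial (Fin m) ℂ)))‖ ^ 2 ≤ (2 : ℝ) ^ m := by
    have hsub : (∑ e' : Fin m → Bool, C ((ArithmeticFunction.liouville (Nat.ofBits e' + 1) : ℤ) : ℂ) *
        ∏ i : Fin m, (if e' i then X i else (1 : MvPolynomial (Fin m) ℂ))).support ⊆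
        Finset.univ.image
          (fun e : Fin m → Bool => (Finsupp.equivFunOnFinite.symm fun i => (e i).toNat : Fin m →₀ ℕ)) := by
      intro d hd
      rw [mem_support_iff] at hd
      by_contra hni
      refine hd (coeff_liouvillePoly_eq_zero d fun e he => hni ?_)
      exact Finset.mem_image.2 ⟨e, Finset.mem_univ _, he⟩
    refine (Finset.sum_le_sum_of_subset_of_nonneg hsub fun _ _ _ => by positivity).trans ?_
    rw [Finset.sum_image fun e _ e' _ h => expVec_injective m h]
    simp_rw [coeff_expVec_liouvillePoly]
    have h1 : ∀ e : Fin m → Bool,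
        ‖((ArithmeticFunction.liouville (Nat.ofBits e + 1) : ℤ) : ℂ)‖ ^ 2 = 1 := fun e => by
      rw [sq, ← norm_mul, liouville_mul_self, norm_one]
    simp_rw [h1]
    rw [Finset.sum_const, hcard, nsmul_eq_mul, mul_one]
    push_cast
    exact le_rfl
  -- `4^m ≤ (1/2) · 2^m · 2^m`
  rw [hL] at h
  have h4 : (2 : ℝ) ^ m * 2 ^ m = 4 ^ m := by rw [← mul_pow]; norm_num
  have hpos : (0 : ℝ) < 4 ^ m := by positivity
  nlinarith [mul_le_mul_of_nonneg_left hR (by positivity : (0 : ℝ) ≤ 1 / 2 * 2 ^ m)]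

end Summit.ValiantsHypothesis.ValiantsHypothesis.Theorems.LiouvilleSarnak
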